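import Literature.AlgebraicTopology.Homotopy.WeakEquivalenceLifts
import HarnessLib

/-!
# Whitehead's theorem: a weak homotopy equivalence between CW complexes is a homotopy equivalence — proof

Sibling proof file of `WeakHomotopyEquivalence.lean` (D-0014): the named fact
`Literature.AlgebraicTopology.Homotopy.whitehead_exists_homotopyEquiv_of_isWeakHomotopyEquiv` (Hatcher, *Algebraic Topology* (2002),
Thm. 4.5 in the form of p. 352; Miller, *Lectures on Algebraic Topology* (2020), Thm. 46.9) is
DISCHARGED here as `whitehead_exists_homotopyEquiv_of_isWeakHomotopyEquiv_holds`.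

## Proof (Hatcher 2002, Prop. 4.22 ⇒ Thm. 4.5; Miller 2020, Thm. 46.10 ⇒ Thm. 46.9)

For a weak homotopy equivalence `f : X → Y` and any CW complex `K`, every `u : K → Y` lifts
through `f` up to homotopy (`CWLift.exists_lift_homotopic` with `IsWeakHomotopyEquiv.ballLift`:
the cell-by-cell compression argument of Hatcher's Lemma 4.6, files `CWHomotopyLifting.lean`,
`CubeLifting.lean`, `WeakEquivalenceLifts.lean`, `CubeHomotopyExtension.lean`,
`GenLoopPaths.lean`). With `K = Y`, `u = 𝟙`: a map `g : Y → X` with `f ∘ g ≃ 𝟙`. Then `g` is a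
weak homotopy equivalence (two out of three, `IsWeakHomotopyEquiv.of_comp_homotopic_id`), so
with `K = X` there is `h : X → Y` with `g ∘ h ≃ 𝟙`; hence `h ≃ f ∘ g ∘ h ≃ f` and
`g ∘ f ≃ g ∘ h ≃ 𝟙`, i.e. `g` is a two-sided homotopy inverse of `f`. (Empty `X` forces empty
`Y` by `π₀`.)

## References

* A. Hatcher, *Algebraic Topology*, CUP (2002), §4.1, Thm. 4.5 (p. 346), Lemma 4.6,
  Prop. 4.22 (p. 357), p. 352. [HatcherAT2002]
* H. Miller, *Lectures on Algebraic Topology*, World Scientific (2020), Thm. 46.9, Thm. 46.10,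
  Lecture 48. [Miller2020]
-/

noncomputable section

open Set Function
open scoped Topology

universe u v

namespace Literature.AlgebraicTopology.Homotopy

/-- **Whitehead's theorem** (Hatcher 2002, Thm. 4.5 / p. 352; Miller 2020, Thm. 46.9): a weak
homotopy equivalence between (Hausdorff) CW complexes is a homotopy equivalence — the named fact
`whitehead_exists_homotopyEquiv_of_isWeakHomotopyEquiv` DISCHARGED (module docstring for the
proof). [cite: HatcherAT2002, Thm. 4.5 and p. 352] -/
theorem whitehead_exists_homotopyEquiv_of_isWeakHomotopyEquiv_holds :
    whitehead_exists_homotopyEquiv_of_isWeakHomotopyEquiv.{u, v} := by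
  intro X Y _ _ _ _ _ _ f hf
  rcases isEmpty_or_nonempty X with hX | hX
  · -- `X = ∅` forces `Y = ∅` (surjectivity on `π₀`)
    have hY : IsEmpty Y := ⟨fun y => by
      obtain ⟨a, -⟩ := hf.1.2 (ZerothHomotopy.mk y)
      induction a using ZerothHomotopy.rec with
      | mk x => exact hX.elim x⟩
    let g : C(Y, X) :=
      { toFun := fun y => hY.elim y
        continuous_toFun := continuous_def.2 fun s _ => by
          rw [Set.eq_empty_of_isEmpty (_ ⁻¹' s)]
          exact isOpen_empty }
    have h1 : g.comp f = ContinuousMap.id X := by ext x; exact hX.elim x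
    have h2 : f.comp g = ContinuousMap.id Y := by ext y; exact hY.elim y
    exact ⟨⟨f, g, by rw [h1], by rw [h2]⟩, rfl⟩
  · -- a right homotopy inverse `g` by lifting `𝟙_Y` through `f`
    obtain ⟨g, hg⟩ := CWLift.exists_lift_homotopic f hf.ballLift (ContinuousMap.id Y)
    -- `g` is a weak homotopy equivalence; lift `𝟙_X` through `g`
    have hgw : IsWeakHomotopyEquiv g := hf.of_comp_homotopic_id hg.symm
    haveI : Nonempty Y := ⟨f (Classical.arbitrary X)⟩
    obtain ⟨h, hh⟩ := CWLift.exists_lift_homotopic g hgw.ballLift (ContinuousMap.id X)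
    -- `h ≃ f g h ≃ f`
    have hhf : h.Homotopic f := by
      have e1 : h.Homotopic ((f.comp g).comp h) := by
        have := hg.comp (ContinuousMap.Homotopic.refl h)
        rwa [ContinuousMap.id_comp] at this
      have e2 : ((f.comp g).comp h).Homotopic f := by
        have := (ContinuousMap.Homotopic.refl f).comp hh.symm
        rwa [ContinuousMap.comp_id, ← ContinuousMap.comp_assoc] at this
      exact e1.trans e2
    refine ⟨⟨f, g, ?_, hg.symm⟩, rfl⟩
    -- `g f ≃ g h ≃ 𝟙_X`
    exact ((ContinuousMap.Homotopic.refl g).comp hhf.symm).trans hh.symm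

end Literature.AlgebraicTopology.Homotopy

end
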